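import Summits.ResolutionOfSingularities.ResolutionOfSingularities.Theorems.FrobeniusClosingSteerEventualMonomial
import Summits.ResolutionOfSingularities.ResolutionOfSingularities.Theorems.FrobeniusClosingSteerQuadraticStepLemmas
import Mathlib.Algebra.CharP.Lemmas
import HarnessLib

/-!
# Crux `Steer` (stmt-ResolutionOfSingularities-16345), line `switching_dichotomy`: EVENTUAL STEPS and ETERNAL AFFINE RUNS
# inside the (α) heart (strongly switching, rank one, never log-final)

OURS (campaign `res-hironaka`, rung L ★L-G4, slot W4.1, chain W4.1; seat `res-L0-w41-stub-4` g3; Theses-free helper for the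
holder res-L0-w41-lead-1's line `switching_dichotomy` and for the chain planner's words of record CHAIN v5.4 §B5; replaces
the role of no printed item; NOT a statement of the manuscript under review [claim: Hironaka2017, status: under-review];
AI-produced, which is weaker than expert review). Sequel of `FrobeniusClosingSteerEventualMonomial.lean` (E-1 eventual
monomialization, E-2 rebirth normal form). The line's vocabulary (`IsFracOf`, `ToroidalAt`, `IsExcParam`, `IsStrictStep`,
`CanStepAt`, `GenAt`, `IsMaxGenAt`, `MultPAt`, `IsTorsorRun`) is UNFOLDED into binders in the skeleton's verbatim shapes.

Standing hypotheses (the (α) heart of the phase machine, CHAIN v5.4 §B5): the point sequence `R` of a base `A₀ ⊆ O`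
regular at the centre of `O` is STRONGLY SWITCHING, `O` is ARCHIMEDEAN on fractions of `A₀` (rank one), and NO member is
toroidally log-final for any exchanged radicand (`∀ N t₂, t₂ ∉ Frac A₀ → ¬ ToroidalAt p (R N) (t₂ ^ p)` — the E2 half of
`∀ M, ¬ LogExitAt (R M) p A₀ t`). Let `s` be a generator of the torsor over a member `R i₀` (`s ^ p ∈ R i₀`, `s ∉ Frac A₀`)
which can be cleaned into the maximal ideal (`v (s ^ p − g ^ p) < 1` for some `g ∈ R i₀`; automatic when the residue
field of `R i₀` is perfect).

* **E-3 `eventually_canStepAt`.** From some stage on, `s` CAN STEP at EVERY member: for all `M ≥ N` there is a strict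
  transform step `s = x_M · s'' + g` (`x_M` an exceptional parameter of `R M`, `g ∈ R M`) with `s'' ^ p ∈ R (M + 1)`.
  (By E-2 the cleaned radicand is `(s − g) ^ p = m ^ p · u` at some member `R N` with `v m < 1`; at `M ≥ N`,
  `s'' := (s − g) / x_M` has `s'' ^ p = (m / x_M) ^ p · u ∈ R (M + 1)`.)
* **E-3′ `eventually_not_isMaxGenAt`.** Hence in a tail WITHOUT multiplicity-`p` re-entries (`¬ MultPAt O (R M) p t` for
  `M ≥ M₀`, as in Φ3ᴸˢ's quiet tail) `s` is NOT a maximal generator at any late member: quiet tails must renew their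
  maximal generators for ever (a quiet tail is an infinite ascent of simple orders, never quiet at the level of orders).
* **E-4 `exists_isTorsorRun_of_tail`.** There is a value budget `β = v m` (`0 < β < 1` multiplicatively: `m ≠ 0`,
  `v m < 1`) such that at every stage `M ≥ N` at which the exceptional values have a TAIL PRODUCT STAYING ABOVE `β`
  (`∀ j, β < ∏_{i<j} v (x (M + i))` — additively: `Σ_{i ≥ M} v(𝔪_i) < v(m)`, automatic for large `M` whenever GMR's
  `s = Σ_i v(𝔪_i)` is finite, which by Heinzer–Olberding–Toeniskoetter 2017 Prop. 6.2 is the case as soon as the rational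
  rank is `≥ 2`) the generator `s` starts an ETERNAL AFFINE TORSOR RUN along `i ↦ R (M + i)`:
  `u 0 = s`, `u (j + 1) = (s − g) / (x_M ⋯ x_{M+j})`. So the residual Φ4ᴸˢ (whose last hypothesis forbids eternal affine
  runs from every generator at every stage) is only ever inhabited by data with `Σ_i v(𝔪_i) = ∞`, hence (HOT 2017
  Prop. 6.2, [corpus: paper:arxiv-1512.03848 p.15 L1–L2]) of rational rank one; and the composition `concl_of_phasesSSL`
  tests eternal runs BEFORE the Φ3ᴸˢ/Φ4ᴸˢ split, so the same confinement is available to Φ3ᴸˢ for free.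

Sources: W. Heinzer, K. A. Loper, B. Olberding, H. Schoutens, M. Toeniskoetter, *Ideal theory of infinite directed unions
of local quadratic transforms*, J. Algebra 474 (2017), Prop. 4.4; W. Heinzer, B. Olberding, M. Toeniskoetter, *Asymptotic
properties of infinite directed unions of local quadratic transforms*, J. Algebra 479 (2017) = arXiv:1512.03848, Prop. 6.2;
A. Granja, M. C. Martínez, C. Rodríguez, *Valuations dominating regular local rings and proximity relations*, J. Pure
Appl. Algebra 209 (2007) (the invariant `s = Σ v(𝔪_i)`).
-/

-- `Summit.<S>.<S>.…` duplicates the summit name by design (single-problem summit).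
set_option linter.dupNamespace false

open IsLocalRing
open Literature.AlgebraicGeometry.Resolution

namespace Summit.ResolutionOfSingularities.ResolutionOfSingularities.Theorems.SwitchingDichotomy

namespace EventualMonomial

variable {k K : Type} [Field k] [Field K] [Algebra k K]

/-! ## Bookkeeping along the sequence -/

/-- Along the point sequence of a base regular at the centre: every member is regular local, dominated by `O`, the
sequence is monotone, and membership in a maximal ideal is `v < 1`. [folklore] -/
theorem sequence_facts (O : ValuationSubring K) (A₀ : Subalgebra k K) (h₀ : A₀.toSubring ≤ O.toSubring)
    (hreg : IsRegularLocalRing (Localization.AtPrime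
      (Ideal.comap (Subring.inclusion h₀) (IsLocalRing.maximalIdeal O))))
    (R : ℕ → Subring K) (hR0 : R 0 = locAtCentre A₀.toSubring O)
    (hstep : ∀ i, IsQuadraticTransformAlong O (R i) (R (i + 1))) :
    (∀ i, IsRegularLocalRing (R i)) ∧ (∀ i, SubringDominates (R i) O.toSubring) ∧ Monotone R ∧
      ∀ i, ∀ x ∈ R i, ∃ y ∈ A₀, ∃ z ∈ A₀, z ≠ 0 ∧ x = y / z := by
  have hreg₀ : IsRegularLocalRing (R 0) := by
    rw [hR0]
    exact (isRegularLocalRing_locAtCentre_iff h₀).mpr hreg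
  have hdom₀ : SubringDominates (R 0) O.toSubring := by
    rw [hR0]
    exact subringDominates_locAtCentre h₀
  have hF0 : R 0 ≤ (Subfield.closure ((A₀.toSubring : Subring K) : Set K)).toSubring := by
    rw [hR0]
    exact locAtCentre_le_subfield O fun x hx => Subfield.subset_closure hx
  refine ⟨isRegularLocalRing_sequence hreg₀ hstep, fun i => (sequence_dominates hdom₀ hstep i).1,
    sequence_monotone hstep, fun i x hx => ?_⟩
  obtain ⟨y, hy, z, hz, hz0, hxyz⟩ :=
    exists_div_eq_of_mem_subfieldClosure (sequence_le_subfield hF0 hstep i hx)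
  exact ⟨y, hy, z, hz, hz0, hxyz⟩

/-- Fractions of elements of `A₀` are closed under subtraction. [folklore] -/
theorem isFracOf_sub (A₀ : Subalgebra k K) {x y : K}
    (hx : ∃ a ∈ A₀, ∃ b ∈ A₀, b ≠ 0 ∧ x = a / b) (hy : ∃ a ∈ A₀, ∃ b ∈ A₀, b ≠ 0 ∧ y = a / b) :
    ∃ a ∈ A₀, ∃ b ∈ A₀, b ≠ 0 ∧ x - y = a / b :=
  (exists_div_iff_mem_closure A₀ _).mpr
    (sub_mem ((exists_div_iff_mem_closure A₀ x).mp hx) ((exists_div_iff_mem_closure A₀ y).mp hy))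

/-! ## E-3 · every generator can eventually step, at every later member -/

/-- **E-3 · eventual steps.** In the (α) heart (strongly switching, archimedean, no member toroidally log-final) a
generator `s` over `R i₀` (`s ^ p ∈ R i₀`, `s ∉ Frac A₀`) which can be cleaned into the maximal ideal
(`v (s ^ p − g ^ p) < 1`, `g ∈ R i₀`) CAN STEP at every member from some stage on: for all `M ≥ N`,
`CanStepAt O (R M) p s` (unfolded: a strict-transform step `s = x · s'' + g'` with `x` an exceptional parameter of
`R M`, `g' ∈ R M`, and `s'' ^ p` in the next member). OURS. [cite: HeinzerEtAl2015, Prop. 4.4] [folklore] -/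
theorem eventually_canStepAt (p : ℕ) (hp : p.Prime) [CharP k p] (O : ValuationSubring K)
    (A₀ : Subalgebra k K) (h₀ : A₀.toSubring ≤ O.toSubring)
    (hreg : IsRegularLocalRing (Localization.AtPrime
      (Ideal.comap (Subring.inclusion h₀) (IsLocalRing.maximalIdeal O))))
    (R : ℕ → Subring K) (hR0 : R 0 = locAtCentre A₀.toSubring O)
    (hstep : ∀ i, IsQuadraticTransformAlong O (R i) (R (i + 1)))
    (hSS : ∀ x : K, x ∈ O → (∃ y ∈ A₀, ∃ z ∈ A₀, z ≠ 0 ∧ x = y / z) → ∃ i, x ∈ R i)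
    (hArch : ∀ x y : K, (∃ a ∈ A₀, ∃ b ∈ A₀, b ≠ 0 ∧ x = a / b) →
      (∃ a ∈ A₀, ∃ b ∈ A₀, b ≠ 0 ∧ y = a / b) → y ≠ 0 → O.valuation x < 1 →
      ∃ n : ℕ, O.valuation x ^ n < O.valuation y)
    (hnl : ∀ (N : ℕ) (_ : IsLocalRing (R N)) (t₂ : K), ¬ (∃ y ∈ A₀, ∃ z ∈ A₀, z ≠ 0 ∧ t₂ = y / z) →
      ¬ ∃ (s : ℕ) (z : Fin s → R N), IsRsopPart z ∧ ∃ (m : Fin s → ℕ), (∃ l, ¬ p ∣ m l) ∧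
        ∃ u : R N, IsUnit u ∧ t₂ ^ p = (∏ l, ((z l : R N) : K) ^ m l) * (u : K))
    (i₀ : ℕ) (s : K) (hsR : s ^ p ∈ R i₀) (hsF : ¬ ∃ y ∈ A₀, ∃ z ∈ A₀, z ≠ 0 ∧ s = y / z)
    (hclean : ∃ g ∈ R i₀, O.valuation (s ^ p - g ^ p) < 1) :
    ∃ N : ℕ, i₀ ≤ N ∧ ∀ M, N ≤ M →
      ∃ (S₁ : Subring K) (s'' : K), IsQuadraticTransformAlong O (R M) S₁ ∧
        (∃ x g : K, (x ∈ R M ∧ x ≠ 0 ∧ O.valuation x < 1 ∧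
            ∀ y ∈ R M, O.valuation y < 1 → O.valuation y ≤ O.valuation x) ∧
          g ∈ R M ∧ s = x * s'' + g) ∧ s'' ^ p ∈ S₁ := by
  classical
  haveI : Fact p.Prime := ⟨hp⟩
  haveI : CharP K p := charP_of_injective_algebraMap (algebraMap k K).injective p
  obtain ⟨hRreg, hRdom, hmono, hRfrac⟩ := sequence_facts O A₀ h₀ hreg R hR0 hstep
  have hRO : ∀ i, R i ≤ O.toSubring := fun i => (hRdom i).1
  have hmax : ∀ i (a : R i), a ∈ maximalIdeal (R i) ↔ O.valuation (a : K) < 1 := fun i =>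
    (subringDominates_valuationSubring_iff (hRO i)).mp (hRdom i)
  -- the cleaned radicand `b' := (s - g) ^ p = s ^ p - g ^ p`
  obtain ⟨g, hgR, hvb⟩ := hclean
  have ht₂F : ¬ ∃ y ∈ A₀, ∃ z ∈ A₀, z ≠ 0 ∧ s - g = y / z := by
    intro h
    have := isFracOf_sub A₀ (x := s - g) (y := -g) h
      (by obtain ⟨a, ha, b, hb, hb0, hgab⟩ := hRfrac i₀ g hgR
          exact ⟨-a, A₀.neg_mem ha, b, hb, hb0, by rw [hgab, neg_div]⟩)
    rw [sub_neg_eq_add, sub_add_cancel] at this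
    exact hsF this
  have ht₂0 : s - g ≠ 0 := by
    intro h
    exact ht₂F ⟨0, A₀.zero_mem, 1, A₀.one_mem, one_ne_zero, by rw [h, div_one]⟩
  have hb' : (s - g) ^ p = s ^ p - g ^ p := sub_pow_char s g
  have hb'R : (s - g) ^ p ∈ R i₀ := by
    rw [hb']
    exact sub_mem hsR (pow_mem hgR p)
  -- E-2: `(s - g) ^ p = m ^ p · u` at a member `R N`, `v m < 1`
  obtain ⟨N, hN, m, hmR, u, hu, hm0, hbe⟩ :=
    exists_pow_mul_unit_of_forall_not_toroidal p O A₀ h₀ hreg R hR0 hstep hSS hArch i₀ ((s - g) ^ p)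
      hb'R (pow_ne_zero p ht₂0) (fun M hM => hnl M hM (s - g) ht₂F)
  have hvu : O.valuation (u : K) = 1 := valuation_eq_one_of_isUnit_subring (hRO N) hu
  have hvm : O.valuation m < 1 := by
    by_contra hcon
    have h1 : 1 ≤ O.valuation m ^ p := one_le_pow₀ (not_lt.mp hcon)
    have h2 : O.valuation ((s - g) ^ p) < 1 := by rw [hb']; exact hvb
    rw [hbe, map_mul, map_pow, hvu, mul_one] at h2
    exact not_lt.mpr h1 h2
  refine ⟨N, hN, fun M hNM => ?_⟩
  -- the exceptional parameter of `R M` and the step `s = x · ((s - g) / x) + g`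
  obtain ⟨hloc, x, hxm, hx0, hval, -⟩ := (hstep M).exists_eq_locAtCentre
  have hxK0 : ((x : R M) : K) ≠ 0 := fun h => hx0 (Subtype.ext h)
  have hvx : O.valuation ((x : R M) : K) < 1 := (hmax M x).mp hxm
  have hxmax : ∀ y ∈ R M, O.valuation y < 1 → O.valuation y ≤ O.valuation ((x : R M) : K) :=
    fun y hy hvy => hval ⟨y, hy⟩ ((hmax M ⟨y, hy⟩).mpr hvy)
  have hmM : m ∈ R M := hmono hNM hmR
  have hdiv : m / ((x : R M) : K) ∈ R (M + 1) :=
    QuadraticStep.div_mem_of_isQuadraticTransformAlong (hstep M) (hRdom M) x.2 hxK0 hvx hxmax hmM hvm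
  have huM : (u : K) ∈ R (M + 1) := hmono (hNM.trans (Nat.le_succ M)) u.2
  refine ⟨R (M + 1), (s - g) / ((x : R M) : K), hstep M,
    ⟨((x : R M) : K), g, ⟨x.2, hxK0, hvx, hxmax⟩, hmono (hN.trans hNM) hgR, ?_⟩, ?_⟩
  · rw [mul_div_cancel₀ _ hxK0, sub_add_cancel]
  · have hpow : ((s - g) / ((x : R M) : K)) ^ p = (m / ((x : R M) : K)) ^ p * (u : K) := by
      rw [div_pow, hbe, div_pow, div_mul_eq_mul_div]
    rw [hpow]
    exact Subring.mul_mem _ (Subring.pow_mem _ hdiv p) huM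

/-! ## E-3′ · quiet tails renew their maximal generators -/

/-- **E-3′ · in a tail without multiplicity-`p` re-entries no generator stays maximal.** If from `M₀` on no MAXIMAL
generator can step (`¬ MultPAt O (R M) p t`, unfolded, for `M ≥ M₀` — the quiet tail of Φ3ᴸˢ), then a generator `s`
as in `eventually_canStepAt` is NOT a maximal generator (`¬ IsMaxGenAt (R M) p t s`, unfolded) at any member
`M ≥ max N M₀`: it can step there, so maximality would be a re-entry. OURS. [folklore] -/
theorem eventually_not_isMaxGenAt (p : ℕ) (hp : p.Prime) [CharP k p] (O : ValuationSubring K)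
    (A₀ : Subalgebra k K) (h₀ : A₀.toSubring ≤ O.toSubring)
    (hreg : IsRegularLocalRing (Localization.AtPrime
      (Ideal.comap (Subring.inclusion h₀) (IsLocalRing.maximalIdeal O))))
    (R : ℕ → Subring K) (hR0 : R 0 = locAtCentre A₀.toSubring O)
    (hstep : ∀ i, IsQuadraticTransformAlong O (R i) (R (i + 1)))
    (hSS : ∀ x : K, x ∈ O → (∃ y ∈ A₀, ∃ z ∈ A₀, z ≠ 0 ∧ x = y / z) → ∃ i, x ∈ R i)
    (hArch : ∀ x y : K, (∃ a ∈ A₀, ∃ b ∈ A₀, b ≠ 0 ∧ x = a / b) →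
      (∃ a ∈ A₀, ∃ b ∈ A₀, b ≠ 0 ∧ y = a / b) → y ≠ 0 → O.valuation x < 1 →
      ∃ n : ℕ, O.valuation x ^ n < O.valuation y)
    (hnl : ∀ (N : ℕ) (_ : IsLocalRing (R N)) (t₂ : K), ¬ (∃ y ∈ A₀, ∃ z ∈ A₀, z ≠ 0 ∧ t₂ = y / z) →
      ¬ ∃ (s : ℕ) (z : Fin s → R N), IsRsopPart z ∧ ∃ (m : Fin s → ℕ), (∃ l, ¬ p ∣ m l) ∧
        ∃ u : R N, IsUnit u ∧ t₂ ^ p = (∏ l, ((z l : R N) : K) ^ m l) * (u : K))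
    (t : K) (M₀ : ℕ)
    (hq : ∀ M, M₀ ≤ M → ¬ ∃ s' : K,
      ((s' ^ p ∈ R M ∧ t ∈ Subring.closure (insert s' (R M : Set K))) ∧
        ∀ s'' : K, s'' ^ p ∈ R M → s' ∈ Subring.closure (insert s'' (R M : Set K)) →
          s'' ∈ Subring.closure (insert s' (R M : Set K))) ∧
      ∃ (S₁ : Subring K) (s'' : K), IsQuadraticTransformAlong O (R M) S₁ ∧
        (∃ x g : K, (x ∈ R M ∧ x ≠ 0 ∧ O.valuation x < 1 ∧
            ∀ y ∈ R M, O.valuation y < 1 → O.valuation y ≤ O.valuation x) ∧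
          g ∈ R M ∧ s' = x * s'' + g) ∧ s'' ^ p ∈ S₁)
    (i₀ : ℕ) (s : K) (hsR : s ^ p ∈ R i₀) (hsF : ¬ ∃ y ∈ A₀, ∃ z ∈ A₀, z ≠ 0 ∧ s = y / z)
    (hclean : ∃ g ∈ R i₀, O.valuation (s ^ p - g ^ p) < 1) :
    ∃ N : ℕ, i₀ ≤ N ∧ ∀ M, N ≤ M → M₀ ≤ M →
      ¬ ((s ^ p ∈ R M ∧ t ∈ Subring.closure (insert s (R M : Set K))) ∧
        ∀ s'' : K, s'' ^ p ∈ R M → s ∈ Subring.closure (insert s'' (R M : Set K)) →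
          s'' ∈ Subring.closure (insert s (R M : Set K))) := by
  obtain ⟨N, hN, hstepN⟩ :=
    eventually_canStepAt p hp O A₀ h₀ hreg R hR0 hstep hSS hArch hnl i₀ s hsR hsF hclean
  exact ⟨N, hN, fun M hNM hM₀ hmax => hq M hM₀ ⟨s, hmax, hstepN M hNM⟩⟩

/-! ## E-4 · a summable tail of exceptional values starts an eternal affine run -/

/-- **E-4 · eternal affine runs from a summable tail.** In the (α) heart, for a generator `s` as in
`eventually_canStepAt` there are a stage `N ≥ i₀` and a budget `m` (`m ≠ 0`, `v m < 1`; the `p`-th root, up to a unit,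
of the cleaned radicand `s ^ p − g ^ p = m ^ p · u` at `R N`) such that at every `M ≥ N`, for every choice of
exceptional parameters `x j` of the members `R (M + j)` whose TAIL PRODUCT STAYS ABOVE THE BUDGET
(`∀ j, v m < ∏_{i<j} v (x i)`, i.e. additively `Σ_{i} v(x_i) < v(m)`), the sequence `u 0 = s`,
`u (j+1) = (s − g) / (x 0 ⋯ x j)` is an ETERNAL affine torsor run along `j ↦ R (M + j)` (`IsTorsorRun` unfolded:
`u 0 = s`, `u j ^ p ∈ R (M + j)`, consecutive members linked by strict-transform steps; `u` is built by recursion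
on the quotients `m_0 = m`, `m_{j+1} = m_j / x j`). Consequently the residual Φ4ᴸˢ,
which forbids eternal affine runs from every generator at every stage, only meets data whose exceptional values have
divergent sum (`Σ_i v(𝔪_i) = ∞`), hence rational rank one (Heinzer–Olberding–Toeniskoetter 2017, Prop. 6.2). OURS.
[cite: HeinzerEtAl2015, Prop. 4.4] [cite: HeinzerOlberdingToeniskoetter2017, Prop. 6.2] [folklore] -/
theorem exists_isTorsorRun_of_tail (p : ℕ) (hp : p.Prime) [CharP k p] (O : ValuationSubring K)
    (A₀ : Subalgebra k K) (h₀ : A₀.toSubring ≤ O.toSubring)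
    (hreg : IsRegularLocalRing (Localization.AtPrime
      (Ideal.comap (Subring.inclusion h₀) (IsLocalRing.maximalIdeal O))))
    (R : ℕ → Subring K) (hR0 : R 0 = locAtCentre A₀.toSubring O)
    (hstep : ∀ i, IsQuadraticTransformAlong O (R i) (R (i + 1)))
    (hSS : ∀ x : K, x ∈ O → (∃ y ∈ A₀, ∃ z ∈ A₀, z ≠ 0 ∧ x = y / z) → ∃ i, x ∈ R i)
    (hArch : ∀ x y : K, (∃ a ∈ A₀, ∃ b ∈ A₀, b ≠ 0 ∧ x = a / b) →
      (∃ a ∈ A₀, ∃ b ∈ A₀, b ≠ 0 ∧ y = a / b) → y ≠ 0 → O.valuation x < 1 →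
      ∃ n : ℕ, O.valuation x ^ n < O.valuation y)
    (hnl : ∀ (N : ℕ) (_ : IsLocalRing (R N)) (t₂ : K), ¬ (∃ y ∈ A₀, ∃ z ∈ A₀, z ≠ 0 ∧ t₂ = y / z) →
      ¬ ∃ (s : ℕ) (z : Fin s → R N), IsRsopPart z ∧ ∃ (m : Fin s → ℕ), (∃ l, ¬ p ∣ m l) ∧
        ∃ u : R N, IsUnit u ∧ t₂ ^ p = (∏ l, ((z l : R N) : K) ^ m l) * (u : K))
    (i₀ : ℕ) (s : K) (hsR : s ^ p ∈ R i₀) (hsF : ¬ ∃ y ∈ A₀, ∃ z ∈ A₀, z ≠ 0 ∧ s = y / z)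
    (hclean : ∃ g ∈ R i₀, O.valuation (s ^ p - g ^ p) < 1) :
    ∃ N : ℕ, i₀ ≤ N ∧ ∃ (m : K) (g : K), m ≠ 0 ∧ O.valuation m < 1 ∧ m ∈ R N ∧ g ∈ R i₀ ∧
      ∀ M, N ≤ M → ∀ x : ℕ → K,
        (∀ j, x j ∈ R (M + j) ∧ x j ≠ 0 ∧ O.valuation (x j) < 1 ∧
          ∀ y ∈ R (M + j), O.valuation y < 1 → O.valuation y ≤ O.valuation (x j)) →
        (∀ j, O.valuation m < ∏ i ∈ Finset.range j, O.valuation (x i)) →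
        ∃ u : ℕ → K, u 0 = s ∧ (∀ j, u j ^ p ∈ R (M + j)) ∧
          ∀ j, ∃ x' g' : K, (x' ∈ R (M + j) ∧ x' ≠ 0 ∧ O.valuation x' < 1 ∧
              ∀ y ∈ R (M + j), O.valuation y < 1 → O.valuation y ≤ O.valuation x') ∧
            g' ∈ R (M + j) ∧ u j = x' * u (j + 1) + g' := by
  classical
  haveI : Fact p.Prime := ⟨hp⟩
  haveI : CharP K p := charP_of_injective_algebraMap (algebraMap k K).injective p
  obtain ⟨hRreg, hRdom, hmono, hRfrac⟩ := sequence_facts O A₀ h₀ hreg R hR0 hstep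
  have hRO : ∀ i, R i ≤ O.toSubring := fun i => (hRdom i).1
  -- the cleaned radicand `(s - g) ^ p = m ^ p · u` at `R N` (as in E-3)
  obtain ⟨g, hgR, hvb⟩ := hclean
  have ht₂F : ¬ ∃ y ∈ A₀, ∃ z ∈ A₀, z ≠ 0 ∧ s - g = y / z := by
    intro h
    have := isFracOf_sub A₀ (x := s - g) (y := -g) h
      (by obtain ⟨a, ha, b, hb, hb0, hgab⟩ := hRfrac i₀ g hgR
          exact ⟨-a, A₀.neg_mem ha, b, hb, hb0, by rw [hgab, neg_div]⟩)
    rw [sub_neg_eq_add, sub_add_cancel] at this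
    exact hsF this
  have ht₂0 : s - g ≠ 0 := by
    intro h
    exact ht₂F ⟨0, A₀.zero_mem, 1, A₀.one_mem, one_ne_zero, by rw [h, div_one]⟩
  have hb' : (s - g) ^ p = s ^ p - g ^ p := sub_pow_char s g
  have hb'R : (s - g) ^ p ∈ R i₀ := by
    rw [hb']
    exact sub_mem hsR (pow_mem hgR p)
  obtain ⟨N, hN, m, hmR, u, hu, hm0, hbe⟩ :=
    exists_pow_mul_unit_of_forall_not_toroidal p O A₀ h₀ hreg R hR0 hstep hSS hArch i₀ ((s - g) ^ p)
      hb'R (pow_ne_zero p ht₂0) (fun M hM => hnl M hM (s - g) ht₂F)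
  have hvu : O.valuation (u : K) = 1 := valuation_eq_one_of_isUnit_subring (hRO N) hu
  have hvm : O.valuation m < 1 := by
    by_contra hcon
    have h1 : 1 ≤ O.valuation m ^ p := one_le_pow₀ (not_lt.mp hcon)
    have h2 : O.valuation ((s - g) ^ p) < 1 := by rw [hb']; exact hvb
    rw [hbe, map_mul, map_pow, hvu, mul_one] at h2
    exact not_lt.mpr h1 h2
  refine ⟨N, hN, m, g, hm0, hvm, hmR, hgR, fun M hNM x hx htail => ?_⟩
  -- the quotients `q j := m / (x 0 ⋯ x (j-1))`: value `v m / ∏_{i<j} v (x i) < 1`, members of `R (M + j)`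
  have hx0 : ∀ j, x j ≠ 0 := fun j => (hx j).2.1
  let q : ℕ → K := fun j => Nat.rec (motive := fun _ => K) m (fun j qj => qj / x j) j
  have hq0 : q 0 = m := rfl
  have hqs : ∀ j, q (j + 1) = q j / x j := fun j => rfl
  have hqv : ∀ j, O.valuation (q j) * ∏ i ∈ Finset.range j, O.valuation (x i) = O.valuation m := by
    intro j
    induction j with
    | zero => rw [hq0, Finset.prod_range_zero, mul_one]
    | succ j ih =>
      have hxj : O.valuation (x j) ≠ 0 := (map_ne_zero _).mpr (hx0 j)
      rw [Finset.prod_range_succ, hqs, map_div₀, ← ih, mul_comm (∏ i ∈ Finset.range j, O.valuation (x i)),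
        ← mul_assoc, div_mul_cancel₀ _ hxj, mul_comm]
  have hqlt : ∀ j, O.valuation (q j) < 1 := by
    intro j
    have h := htail j
    rw [← hqv j] at h
    by_contra hcon
    have : ∏ i ∈ Finset.range j, O.valuation (x i) ≤
        O.valuation (q j) * ∏ i ∈ Finset.range j, O.valuation (x i) :=
      le_mul_of_one_le_left zero_le (not_lt.mp hcon)
    exact not_lt.mpr this h
  have hqmem : ∀ j, q j ∈ R (M + j) := by
    intro j
    induction j with
    | zero => rw [hq0]; exact hmono hNM hmR
    | succ j ih =>
      rw [hqs, ← Nat.add_assoc]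
      exact QuadraticStep.div_mem_of_isQuadraticTransformAlong (hstep (M + j)) (hRdom (M + j)) (hx j).1
        (hx0 j) (hx j).2.2.1 (hx j).2.2.2 ih (hqlt j)
  -- the run `u 0 = s`, `u (j+1) = (s - g) / m · q (j+1)`
  let u' : ℕ → K := fun j => Nat.rec (motive := fun _ => K) s (fun j _ => (s - g) / m * q (j + 1)) j
  have hu0 : u' 0 = s := rfl
  have hus : ∀ j, u' (j + 1) = (s - g) / m * q (j + 1) := fun j => rfl
  refine ⟨u', hu0, ?_, ?_⟩
  · intro j
    cases j with
    | zero => rw [hu0]; exact hmono (hN.trans hNM) hsR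
    | succ j =>
      have hpow : ((s - g) / m * q (j + 1)) ^ p = (q (j + 1)) ^ p * (u : K) := by
        rw [mul_pow, div_pow, hbe, mul_div_cancel_left₀ _ (pow_ne_zero p hm0), mul_comm]
      rw [hus, hpow]
      exact Subring.mul_mem _ (Subring.pow_mem _ (hqmem (j + 1)) p)
        (hmono (hNM.trans (Nat.le_add_right M (j + 1))) u.2)
  · intro j
    cases j with
    | zero =>
      refine ⟨x 0, g, hx 0, ?_, ?_⟩
      · simpa using hmono (hN.trans hNM) hgR
      · rw [hu0, hus, hqs, hq0, ← mul_div_assoc, mul_div_cancel₀ _ (hx0 0), div_mul_cancel₀ _ hm0,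
          sub_add_cancel]
    | succ j =>
      refine ⟨x (j + 1), 0, hx (j + 1), Subring.zero_mem _, ?_⟩
      have h2 : u' (j + 1 + 1) = (s - g) / m * (q (j + 1) / x (j + 1)) := hus (j + 1)
      have key : ∀ A Q X : K, X ≠ 0 → A * Q = X * (A * (Q / X)) + 0 := by
        intro A Q X hX
        rw [add_zero, ← mul_div_assoc, mul_div_cancel₀ _ hX]
      rw [hus j, h2]
      exact key _ _ _ (hx0 (j + 1))

end EventualMonomial

end Summit.ResolutionOfSingularities.ResolutionOfSingularities.Theorems.SwitchingDichotomy
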